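import Literature.NumberTheory.Automorphic.UnitaryGroupArithmeticLevels
import HarnessLib

/-!
# Δ2 BRIDGE, sub-socket S-d — the STRUCTURAL legs of the `V ↦ V̄ := V.transposeAt ῑ₁` transport, K-functorially (§L1)

THIS FILE = §L1 of the pair; §L2 = `CorCM/D2Bridge/LevelConjAlong.lean` (sequel, imports this file).

Cell pub-hodgecm2 (COR-CM), wall-breaker seat wb-10 (prover-pub-hodgecm2-d2bridge-wb-10-g0-0), 2026-08-23; sequel to
`CorCM/D2Bridge/Thm418CTransport` (✔ p372132: `Thm418C` is invariant under a transport package `(φ, eL, eC, eH, eW)` + laws).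
This file SUPPLIES the structural components of that package at a conjugate pair of pins `(V, ι₁)`, `(V.transposeAt ι₀ h, ι₀)`
(`conjugate ι₀ = ι₁`; tree `HodgeCM/Model/PerLOfCanonical`: same Picard code, same realised pieces), leaving exactly the automorphic-side
relabeling (`eC`, `eH`, block law, `res`∕`cmClasses` laws) as explicit binders of `thm418C_transposeAt_iff_of_transport`:

* §L1 (`…D2Bridge.UnitaryGroupConj`, general `E/F`, `c ∈ Aut(E/F)`, `J ∈ M_N(E)`; Literature-grade transport of structure, kept next to
  its only consumer tonight): `glConj` = `c ⊗ 1` on `GL_N(𝔸_E^∞)` as `≃ₜ*`; **`finAdelicConj (hJ : c(J) = J') : U(J)(𝔸_{F,f}) ≃ₜ* U(J')(𝔸_{F,f})`**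
  ([PlatonovRapinchuk1994, §5.1]: apply `c ⊗ 1` to the defining equation; inverse by `c⁻¹ ⊗ 1`; for `c`-hermitian `J`, `J' = Jᵀ`); its action
  on matrices; compatibility with the diagonal embedding `(c ⊗ 1)(γ)_f = (c γ)_f`; and **`arithmeticLevel_map_finAdelicConj`:
  `Γ((c ⊗ 1) K) = c Γ(K)`** in `GL_N(E)`.
* §L2 (model currency): `adelicFinConj V ι₀ h : U(V)(𝔸_f) ≃ₜ* U(Vᵀ)(𝔸_f)`; **`levelConjAlong` ∕ `levelConjEquiv : Level V ≃o Level (V.transposeAt ι₀ h)`**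
  transporting the compact open `K ↦ (c ⊗ 1) K` (K-FUNCTORIAL — unlike the tree's `Level.conjTransposeAt` ∕ `Level.relabel`, which re-choose
  `K` by `Level.ofCongruence`; so the order of levels and `K`-fixed vectors transport, `(eL K).K = φ K.K` by `rfl`);
  `pmsCode_levelConjAlong` ∕ **`pms_levelConjAlong`** (same realised piece); `cohCCast` (cohomology along an equality of varieties);
  **`thm418C_transposeAt_iff_of_transport`** = S-d with `φ`, `eL`, `eW`, `hK` discharged.

KERNEL: definitions by explicit formula + theorems; no instance, no named fact, no `sorry`; nothing cited anew as a record.  Orientation-neutral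
(ORIENTATION-MEMO v1.3: S-d relabels the ι₁∕ῑ₁ seam, it does not remove it).  HC_CM is NOT proved; «Δ2 BRIDGE CLOSED» is NOT claimed.

## References
* V. Platonov, A. Rapinchuk, *Algebraic groups and number theory* (1994), §5.1 (adelic points; functoriality in the defining equations).
* J. W. S. Cassels, A. Fröhlich (eds.), *Algebraic Number Theory* (1967), Ch. VII §1.1 (Galois action on adeles) — through the tree's
  `UnitaryGroup.conjFiniteAdele`.
-/

set_option autoImplicit false

noncomputable section

open NumberField IsDedekindDomain
open scoped Matrix MatrixGroups

namespace Summit.HodgeConjecture.CorCM.D2Bridge.UnitaryGroupConj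

open Literature.NumberTheory.Automorphic Literature.NumberTheory.Automorphic.UnitaryGroup

variable (F E : Type) [Field F] [NumberField F] [Field E] [NumberField E] [Algebra F E]
variable (c : E ≃ₐ[F] E) (N : ℕ)

/-- **`c ⊗ 1` as a ring AUTOMORPHISM of `𝔸_E^∞`** (Mathlib's `MulSemiringAction.toRingEquiv` of the accepted Galois action on the
finite adele ring); its forward map is the tree's `conjFiniteAdele F E c`. [folklore] -/
def conjFiniteAdeleEquiv : FiniteAdeleRing (𝓞 E) E ≃+* FiniteAdeleRing (𝓞 E) E :=
  MulSemiringAction.toRingEquiv (E ≃ₐ[F] E) (FiniteAdeleRing (𝓞 E) E) c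

omit [NumberField F] in
/-- `conjFiniteAdeleEquiv c x = c • x = conjFiniteAdele c x` (definitional). [folklore] -/
@[simp] theorem conjFiniteAdeleEquiv_apply (x : FiniteAdeleRing (𝓞 E) E) :
    conjFiniteAdeleEquiv F E c x = conjFiniteAdele F E c x := rfl

omit [NumberField F] in
/-- The inverse of `c ⊗ 1` is `c⁻¹ ⊗ 1`. [folklore] -/
@[simp] theorem conjFiniteAdeleEquiv_symm_apply (x : FiniteAdeleRing (𝓞 E) E) :
    (conjFiniteAdeleEquiv F E c).symm x = conjFiniteAdele F E c⁻¹ x := rfl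

omit [NumberField F] in
/-- As a ring hom, `conjFiniteAdeleEquiv c` IS `conjFiniteAdele c`. [folklore] -/
theorem conjFiniteAdeleEquiv_toRingHom :
    (conjFiniteAdeleEquiv F E c).toRingHom = conjFiniteAdele F E c := RingHom.ext fun _ => rfl

/-- **`c ⊗ 1` entrywise on `GL_N(𝔸_E^∞)`**, as an isomorphism of topological groups. [folklore] -/
def glConj : GL (Fin N) (FiniteAdeleRing (𝓞 E) E) ≃ₜ* GL (Fin N) (FiniteAdeleRing (𝓞 E) E) where
  toMulEquiv := Units.mapEquiv (RingEquiv.mapMatrix (conjFiniteAdeleEquiv F E c)).toMulEquiv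
  continuous_toFun := by
    change Continuous (Matrix.GeneralLinearGroup.map (conjFiniteAdeleEquiv F E c).toRingHom)
    exact (continuous_conjFiniteAdele F E c).generalLinearGroup_map
  continuous_invFun := by
    change Continuous (Matrix.GeneralLinearGroup.map (conjFiniteAdeleEquiv F E c).symm.toRingHom)
    exact (continuous_conjFiniteAdele F E c⁻¹).generalLinearGroup_map

omit [NumberField F] in
/-- `glConj c g = GL_N(c ⊗ 1) g`. [folklore] -/
@[simp] theorem glConj_apply (g : GL (Fin N) (FiniteAdeleRing (𝓞 E) E)) :
    glConj F E c N g = Matrix.GeneralLinearGroup.map (conjFiniteAdele F E c) g := rfl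

omit [NumberField F] in
/-- `(glConj c).symm g = GL_N(c⁻¹ ⊗ 1) g`. [folklore] -/
@[simp] theorem glConj_symm_apply (g : GL (Fin N) (FiniteAdeleRing (𝓞 E) E)) :
    (glConj F E c N).symm g = Matrix.GeneralLinearGroup.map (conjFiniteAdele F E c⁻¹) g := rfl

omit [NumberField F] in
/-- `(c ⊗ 1)(J ⊗ 1) = (c J) ⊗ 1`: the finite-adelic form of `c(J)` is `c ⊗ 1` applied to the finite-adelic form of `J`. [folklore] -/
theorem finiteAdelicForm_map_galConj (J : Matrix (Fin N) (Fin N) E) :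
    (finiteAdelicForm E N J).map (conjFiniteAdele F E c) = finiteAdelicForm E N (J.map (c : E →+* E)) :=
  Matrix.ext fun i j => by
    simp only [finiteAdelicForm, Matrix.map_apply]
    exact (algebraMap_galConj_finiteAdele F E c (J i j)).symm

omit [NumberField F] in
/-- `(c ⊗ 1) g ∈ U(J')(𝔸_{F,f})` for `g ∈ U(J)(𝔸_{F,f})` and `J' = c(J)`. [folklore] -/
theorem glConj_mem_finAdelic {J J' : Matrix (Fin N) (Fin N) E} (hJ : J.map (c : E →+* E) = J')
    {g : GL (Fin N) (FiniteAdeleRing (𝓞 E) E)} (hg : g ∈ finAdelic F E c N J) :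
    glConj F E c N g ∈ finAdelic F E c N J' := by
  subst hJ
  show Matrix.GeneralLinearGroup.map (conjFiniteAdele F E c) g ∈
    unitaryGroupOfForm (conjFiniteAdele F E c) (finiteAdelicForm E N (J.map (c : E →+* E)))
  rw [← finiteAdelicForm_map_galConj]
  exact map_mem_unitaryGroupOfForm (σ := conjFiniteAdele F E c) (τ := conjFiniteAdele F E c)
    (conjFiniteAdele F E c) (fun _ => rfl) hg

omit [NumberField F] in
/-- `(c⁻¹ ⊗ 1) ((c ⊗ 1) g) = g`. [folklore] -/
@[simp] theorem glConj_inv_glConj (g : GL (Fin N) (FiniteAdeleRing (𝓞 E) E)) :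
    glConj F E c⁻¹ N (glConj F E c N g) = g :=
  (glConj F E c N).symm_apply_apply g

omit [NumberField F] [NumberField E] in
/-- `c⁻¹ (c J) = J` entrywise. [folklore] -/
theorem map_galConj_inv_map_galConj (J : Matrix (Fin N) (Fin N) E) :
    (J.map (c : E →+* E)).map ((c⁻¹ : E ≃ₐ[F] E) : E →+* E) = J :=
  Matrix.ext fun i j => by
    simp only [Matrix.map_apply, AlgEquiv.aut_inv]
    exact c.symm_apply_apply (J i j)

omit [NumberField F] in
/-- `(c⁻¹ ⊗ 1) g ∈ U(J)(𝔸_{F,f})` for `g ∈ U(J')(𝔸_{F,f})`, `J' = c(J)` (the unitary group is still the one of the involution `c`;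
only the conjugating automorphism is inverted). [folklore] -/
theorem glConj_inv_mem_finAdelic {J J' : Matrix (Fin N) (Fin N) E} (hJ : J.map (c : E →+* E) = J')
    {g : GL (Fin N) (FiniteAdeleRing (𝓞 E) E)} (hg : g ∈ finAdelic F E c N J') :
    glConj F E c⁻¹ N g ∈ finAdelic F E c N J := by
  have hJ' : (finiteAdelicForm E N J').map (conjFiniteAdele F E c⁻¹) = finiteAdelicForm E N J := by
    rw [finiteAdelicForm_map_galConj, ← hJ, map_galConj_inv_map_galConj]
  show Matrix.GeneralLinearGroup.map (conjFiniteAdele F E c⁻¹) g ∈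
    unitaryGroupOfForm (conjFiniteAdele F E c) (finiteAdelicForm E N J)
  rw [← hJ']
  exact map_mem_unitaryGroupOfForm (σ := conjFiniteAdele F E c) (τ := conjFiniteAdele F E c)
    (conjFiniteAdele F E c⁻¹) (fun x => by simp only [conjFiniteAdele_apply, inv_smul_smul, smul_inv_smul]) hg

omit [NumberField F] in
/-- Membership transfer: `g ∈ U(J)(𝔸_{F,f}) ↔ (c ⊗ 1) g ∈ U(c J)(𝔸_{F,f})`. [folklore] -/
theorem mem_finAdelic_iff_glConj_mem {J J' : Matrix (Fin N) (Fin N) E} (hJ : J.map (c : E →+* E) = J')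
    (g : GL (Fin N) (FiniteAdeleRing (𝓞 E) E)) :
    g ∈ finAdelic F E c N J ↔ glConj F E c N g ∈ finAdelic F E c N J' := by
  refine ⟨glConj_mem_finAdelic F E c N hJ, fun hg => ?_⟩
  have h := glConj_inv_mem_finAdelic F E c N hJ hg
  rwa [glConj_inv_glConj] at h

/-- **Galois conjugation on finite-adelic points: `U(J)(𝔸_{F,f}) ≃ₜ* U(J')(𝔸_{F,f})` for `J' = c(J)`** (for a `c`-hermitian `J`,
`J' = Jᵀ`): `g ↦ (c ⊗ 1) g`, an isomorphism of topological groups. [cite: PlatonovRapinchuk1994, §5.1] -/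
def finAdelicConj {J J' : Matrix (Fin N) (Fin N) E} (hJ : J.map (c : E →+* E) = J') :
    finAdelic F E c N J ≃ₜ* finAdelic F E c N J' :=
  ContinuousMulEquiv.restrictSubgroup (glConj F E c N) _ _ (mem_finAdelic_iff_glConj_mem F E c N hJ)

omit [NumberField F] in
/-- Underlying matrix of `finAdelicConj g`: `GL_N(c ⊗ 1) g`. [folklore] -/
@[simp] theorem coe_finAdelicConj_apply {J J' : Matrix (Fin N) (Fin N) E} (hJ : J.map (c : E →+* E) = J')
    (g : finAdelic F E c N J) :
    ((finAdelicConj F E c N hJ g : finAdelic F E c N J') : GL (Fin N) (FiniteAdeleRing (𝓞 E) E)) =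
      Matrix.GeneralLinearGroup.map (conjFiniteAdele F E c) (g : GL (Fin N) (FiniteAdeleRing (𝓞 E) E)) := rfl

omit [NumberField F] in
/-- Underlying matrix of `(finAdelicConj).symm g`: `GL_N(c⁻¹ ⊗ 1) g`. [folklore] -/
@[simp] theorem coe_finAdelicConj_symm_apply {J J' : Matrix (Fin N) (Fin N) E} (hJ : J.map (c : E →+* E) = J')
    (g : finAdelic F E c N J') :
    (((finAdelicConj F E c N hJ).symm g : finAdelic F E c N J) : GL (Fin N) (FiniteAdeleRing (𝓞 E) E)) =
      Matrix.GeneralLinearGroup.map (conjFiniteAdele F E c⁻¹) (g : GL (Fin N) (FiniteAdeleRing (𝓞 E) E)) := rfl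

omit [NumberField F] [NumberField E] in
/-- A `c`-hermitian matrix satisfies `c(J) = Jᵀ`, so `finAdelicConj` is `U(J)(𝔸_{F,f}) ≃ₜ* U(Jᵀ)(𝔸_{F,f})`. [folklore] -/
theorem map_galConj_eq_transpose_of_hermitian {J : Matrix (Fin N) (Fin N) E}
    (hJ : ∀ i j, c (J i j) = J j i) : J.map (c : E →+* E) = Jᵀ :=
  Matrix.ext fun i j => hJ i j

omit [NumberField F] [NumberField E] in
/-- `c γ ∈ U(c J)(F)` for `γ ∈ U(J)(F)`: Galois conjugation on RATIONAL points. [folklore] -/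
theorem map_galConj_mem_rational {J J' : Matrix (Fin N) (Fin N) E} (hJ : J.map (c : E →+* E) = J')
    {γ : GL (Fin N) E} (hγ : γ ∈ rational F E c N J) :
    Matrix.GeneralLinearGroup.map (c : E →+* E) γ ∈ rational F E c N J' := by
  rw [← hJ]
  exact map_mem_unitaryGroupOfForm (σ := (c : E →+* E)) (τ := (c : E →+* E)) (c : E →+* E) (fun _ => rfl) hγ

omit [NumberField F] in
/-- **Compatibility with the diagonal embedding**: `(c ⊗ 1) (γ)_f = (c γ)_f` on underlying matrices. [folklore] -/
theorem coe_finAdelicConj_rationalToFinAdelic {J J' : Matrix (Fin N) (Fin N) E} (hJ : J.map (c : E →+* E) = J')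
    (γ : rational F E c N J) :
    ((finAdelicConj F E c N hJ (rationalToFinAdelic F E c N J γ) : finAdelic F E c N J') :
        GL (Fin N) (FiniteAdeleRing (𝓞 E) E)) =
      (rationalToFinAdelic F E c N J' ⟨Matrix.GeneralLinearGroup.map (c : E →+* E) γ,
          map_galConj_mem_rational F E c N hJ γ.2⟩ : GL (Fin N) (FiniteAdeleRing (𝓞 E) E)) := by
  rw [coe_finAdelicConj_apply, coe_rationalToFinAdelic, coe_rationalToFinAdelic]
  refine Units.ext (Matrix.ext fun i j => ?_)
  simp only [Matrix.GeneralLinearGroup.map_apply]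
  exact (algebraMap_galConj_finiteAdele F E c _).symm

omit [NumberField F] [NumberField E] in
/-- `c⁻¹ γ ∈ U(J)(F)` for `γ ∈ U(c J)(F)` (the involution stays `c`). [folklore] -/
theorem map_galConj_inv_mem_rational {J J' : Matrix (Fin N) (Fin N) E} (hJ : J.map (c : E →+* E) = J')
    {γ : GL (Fin N) E} (hγ : γ ∈ rational F E c N J') :
    Matrix.GeneralLinearGroup.map ((c⁻¹ : E ≃ₐ[F] E) : E →+* E) γ ∈ rational F E c N J := by
  have hJ' : J'.map ((c⁻¹ : E ≃ₐ[F] E) : E →+* E) = J := by rw [← hJ, map_galConj_inv_map_galConj]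
  rw [← hJ']
  exact map_mem_unitaryGroupOfForm (σ := (c : E →+* E)) (τ := (c : E →+* E)) ((c⁻¹ : E ≃ₐ[F] E) : E →+* E)
    (fun x => by
      change (c⁻¹ * c) x = (c * c⁻¹) x
      rw [inv_mul_cancel, mul_inv_cancel]) hγ

omit [NumberField F] [NumberField E] in
/-- `c (c⁻¹ γ) = γ` on `GL_N(E)`. [folklore] -/
@[simp] theorem glMap_galConj_glMap_galConj_inv (γ : GL (Fin N) E) :
    Matrix.GeneralLinearGroup.map (c : E →+* E) (Matrix.GeneralLinearGroup.map ((c⁻¹ : E ≃ₐ[F] E) : E →+* E) γ) = γ :=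
  Units.ext (Matrix.ext fun i j => by
    simp only [Matrix.GeneralLinearGroup.map_apply]
    change (c * c⁻¹) _ = _
    rw [mul_inv_cancel]; rfl)

omit [NumberField F] [NumberField E] in
/-- `c⁻¹ (c γ) = γ` on `GL_N(E)`. [folklore] -/
@[simp] theorem glMap_galConj_inv_glMap_galConj (γ : GL (Fin N) E) :
    Matrix.GeneralLinearGroup.map ((c⁻¹ : E ≃ₐ[F] E) : E →+* E) (Matrix.GeneralLinearGroup.map (c : E →+* E) γ) = γ :=
  Units.ext (Matrix.ext fun i j => by
    simp only [Matrix.GeneralLinearGroup.map_apply]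
    change (c⁻¹ * c) _ = _
    rw [inv_mul_cancel]; rfl)

omit [NumberField F] in
/-- **Compatibility with the diagonal embedding, inverse direction**: `(c⁻¹ ⊗ 1) (γ)_f = (c⁻¹ γ)_f`. [folklore] -/
theorem coe_finAdelicConj_symm_rationalToFinAdelic {J J' : Matrix (Fin N) (Fin N) E} (hJ : J.map (c : E →+* E) = J')
    (γ : rational F E c N J') :
    (((finAdelicConj F E c N hJ).symm (rationalToFinAdelic F E c N J' γ) : finAdelic F E c N J) :
        GL (Fin N) (FiniteAdeleRing (𝓞 E) E)) =
      (rationalToFinAdelic F E c N J ⟨Matrix.GeneralLinearGroup.map ((c⁻¹ : E ≃ₐ[F] E) : E →+* E) γ,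
          map_galConj_inv_mem_rational F E c N hJ γ.2⟩ : GL (Fin N) (FiniteAdeleRing (𝓞 E) E)) := by
  rw [coe_finAdelicConj_symm_apply, coe_rationalToFinAdelic, coe_rationalToFinAdelic]
  refine Units.ext (Matrix.ext fun i j => ?_)
  simp only [Matrix.GeneralLinearGroup.map_apply]
  exact (algebraMap_galConj_finiteAdele F E c⁻¹ _).symm

omit [NumberField F] in
/-- **Arithmetic levels transport under Galois conjugation**: `Γ((c ⊗ 1) K) = c(Γ(K))` in `GL_N(E)` — the arithmetic level cut
out by the conjugate compact open of `U(c J)(𝔸_{F,f})` is the conjugate of the arithmetic level cut out by `K ≤ U(J)(𝔸_{F,f})`.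
[cite: PlatonovRapinchuk1994, §5.1] -/
theorem arithmeticLevel_map_finAdelicConj {J J' : Matrix (Fin N) (Fin N) E} (hJ : J.map (c : E →+* E) = J')
    (K : Subgroup (finAdelic F E c N J)) :
    arithmeticLevel F E c N J' (K.map (finAdelicConj F E c N hJ).toMonoidHom) =
      (arithmeticLevel F E c N J K).map (Matrix.GeneralLinearGroup.map (c : E →+* E)) := by
  ext γ'
  rw [mem_arithmeticLevel_iff, Subgroup.mem_map]
  constructor
  · rintro ⟨hγ', k, hk, hkγ⟩
    refine ⟨Matrix.GeneralLinearGroup.map ((c⁻¹ : E ≃ₐ[F] E) : E →+* E) γ', ?_, glMap_galConj_glMap_galConj_inv F E c N γ'⟩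
    rw [mem_arithmeticLevel_iff]
    refine ⟨map_galConj_inv_mem_rational F E c N hJ hγ', ?_⟩
    have hk' : (finAdelicConj F E c N hJ).symm (rationalToFinAdelic F E c N J' ⟨γ', hγ'⟩) = k := by
      rw [← (finAdelicConj F E c N hJ).symm_apply_apply k]
      exact congrArg _ hkγ.symm
    have heq : rationalToFinAdelic F E c N J ⟨Matrix.GeneralLinearGroup.map ((c⁻¹ : E ≃ₐ[F] E) : E →+* E) γ',
        map_galConj_inv_mem_rational F E c N hJ hγ'⟩ = k := by
      rw [← hk']
      exact Subtype.ext (coe_finAdelicConj_symm_rationalToFinAdelic F E c N hJ ⟨γ', hγ'⟩).symm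
    rw [heq]
    exact hk
  · rintro ⟨γ, hγ, rfl⟩
    obtain ⟨hγr, hγK⟩ := mem_arithmeticLevel_iff.1 hγ
    exact ⟨map_galConj_mem_rational F E c N hJ hγr, rationalToFinAdelic F E c N J ⟨γ, hγr⟩, hγK,
      Subtype.ext (coe_finAdelicConj_rationalToFinAdelic F E c N hJ ⟨γ, hγr⟩)⟩

end Summit.HodgeConjecture.CorCM.D2Bridge.UnitaryGroupConj

end
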